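import Mathlib
import HarnessLib

/-!
# Crux U `FreeProbeLawG` (stmt-QuantumFields-23756), line `birth` — assembly part A2a (SPEC, sorried): calculus of the two weight test functions

Lead `ym-line-sgb-k1-g1`. HELPER WANTED (any free width seat; land as
`Theorems/SteinGapBootstrapFreeProbeLawGTestFun.lean --supports stmt-QuantumFields-23756 --as helper`, keeping the statements below
verbatim so the lead's assembly file can import them; post `TAKING-A2a` on the item first).

Setting (abstract, pure calculus on a finite product of reals with the sup norm): index type `ι` (in the assembly: the subtype of a finite
set of plaquettes), `D` colours, coefficients `c : ι → ℝ` (in the assembly: `q ↦ (dω)(q)`), a base index `p₀`, a colour `a`, `δ > 0`.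
For `y : ι → Fin D → ℝ` put `z_b(y) = Σ_q c_q y_q^b`, `x_b(y) = y_{p₀}^b − z_b(y)`, `W(y) = exp(−(δ/2) Σ_b (x_b² + z_b²))`, and the two test
functions `gZ = z_a · W`, `gX = x_a · W`; `vec_q^b = [b = a] c_q` is the direction produced by the Green resummation. Wanted: `C¹`
regularity, the sup bounds `δ^(−1/2)`, operator-norm bounds of the Fréchet derivatives (sup norm on the Pi type!) linear in `1 + Σ|c_q|`,
and the directional derivatives along `vec` in closed form. All statements are def-free (explicit lambdas). HONEST LABEL: RECORD rung
R2ξ-G only; nothing here bears on the Yang–Mills mass gap.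
-/

set_option autoImplicit false

noncomputable section

open Real Finset

namespace Summit.QuantumFields.YangMills.Cruxes.FreeProbeLawG.SteinFree

namespace TestFun

variable {ι : Type*} [Fintype ι] [DecidableEq ι] {D : ℕ} (c : ι → ℝ) (p₀ : ι) (δ : ℝ) (a : Fin D)

/-- `gZ = z_a · W` is `C¹`. -/
theorem contDiff_gZ :
    ContDiff ℝ 1 (fun y : ι → Fin D → ℝ => (∑ q, c q * y q a) *
      Real.exp (-(δ / 2) * ∑ b, ((y p₀ b - ∑ q, c q * y q b) ^ 2 + (∑ q, c q * y q b) ^ 2))) := by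
  sorry

/-- `gX = x_a · W` is `C¹`. -/
theorem contDiff_gX :
    ContDiff ℝ 1 (fun y : ι → Fin D → ℝ => (y p₀ a - ∑ q, c q * y q a) *
      Real.exp (-(δ / 2) * ∑ b, ((y p₀ b - ∑ q, c q * y q b) ^ 2 + (∑ q, c q * y q b) ^ 2))) := by
  sorry

/-- `|gZ| ≤ δ^(−1/2)` (`|z| e^{−δ z²/2} ≤ (eδ)^(−1/2)`). -/
theorem abs_gZ_le (hδ : 0 < δ) (y : ι → Fin D → ℝ) :
    |(∑ q, c q * y q a) *
      Real.exp (-(δ / 2) * ∑ b, ((y p₀ b - ∑ q, c q * y q b) ^ 2 + (∑ q, c q * y q b) ^ 2))| ≤ δ ^ (-(1 / 2 : ℝ)) := by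
  sorry

/-- `|gX| ≤ δ^(−1/2)`. -/
theorem abs_gX_le (hδ : 0 < δ) (y : ι → Fin D → ℝ) :
    |(y p₀ a - ∑ q, c q * y q a) *
      Real.exp (-(δ / 2) * ∑ b, ((y p₀ b - ∑ q, c q * y q b) ^ 2 + (∑ q, c q * y q b) ^ 2))| ≤ δ ^ (-(1 / 2 : ℝ)) := by
  sorry

/-- Operator norm of `D gZ` (sup norm on `ι → Fin D → ℝ`): `‖D gZ(y)‖ ≤ (D + 2)(1 + Σ_q |c_q|)` for `0 < δ ≤ 1`. -/
theorem norm_fderiv_gZ_le (hδ : 0 < δ) (hδ1 : δ ≤ 1) (y : ι → Fin D → ℝ) :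
    ‖fderiv ℝ (fun y : ι → Fin D → ℝ => (∑ q, c q * y q a) *
      Real.exp (-(δ / 2) * ∑ b, ((y p₀ b - ∑ q, c q * y q b) ^ 2 + (∑ q, c q * y q b) ^ 2))) y‖ ≤
      ((D : ℝ) + 2) * (1 + ∑ q, |c q|) := by
  sorry

/-- Operator norm of `D gX`: `‖D gX(y)‖ ≤ (D + 2)(1 + Σ_q |c_q|)` for `0 < δ ≤ 1`. -/
theorem norm_fderiv_gX_le (hδ : 0 < δ) (hδ1 : δ ≤ 1) (y : ι → Fin D → ℝ) :
    ‖fderiv ℝ (fun y : ι → Fin D → ℝ => (y p₀ a - ∑ q, c q * y q a) *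
      Real.exp (-(δ / 2) * ∑ b, ((y p₀ b - ∑ q, c q * y q b) ^ 2 + (∑ q, c q * y q b) ^ 2))) y‖ ≤
      ((D : ℝ) + 2) * (1 + ∑ q, |c q|) := by
  sorry

/-- Directional derivative of `gZ` along `vec_q^b = [b = a] c_q`:
`D gZ(y)[vec] = (Σ c²)·(W − δ z_a² W) + (c_{p₀} − Σ c²)·(−δ x_a z_a W)`. -/
theorem fderiv_gZ_vec (y : ι → Fin D → ℝ) :
    fderiv ℝ (fun y : ι → Fin D → ℝ => (∑ q, c q * y q a) *
      Real.exp (-(δ / 2) * ∑ b, ((y p₀ b - ∑ q, c q * y q b) ^ 2 + (∑ q, c q * y q b) ^ 2))) y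
      (fun q b => if b = a then c q else 0) =
    (∑ q, c q ^ 2) *
        (Real.exp (-(δ / 2) * ∑ b, ((y p₀ b - ∑ q, c q * y q b) ^ 2 + (∑ q, c q * y q b) ^ 2)) -
          δ * (∑ q, c q * y q a) ^ 2 *
            Real.exp (-(δ / 2) * ∑ b, ((y p₀ b - ∑ q, c q * y q b) ^ 2 + (∑ q, c q * y q b) ^ 2))) +
      (c p₀ - ∑ q, c q ^ 2) *
        (-δ * (y p₀ a - ∑ q, c q * y q a) * (∑ q, c q * y q a) *
          Real.exp (-(δ / 2) * ∑ b, ((y p₀ b - ∑ q, c q * y q b) ^ 2 + (∑ q, c q * y q b) ^ 2))) := by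
  sorry

/-- Directional derivative of `gX` along `vec`:
`D gX(y)[vec] = (Σ c²)·(−δ x_a z_a W) + (c_{p₀} − Σ c²)·(W − δ x_a² W)`. -/
theorem fderiv_gX_vec (y : ι → Fin D → ℝ) :
    fderiv ℝ (fun y : ι → Fin D → ℝ => (y p₀ a - ∑ q, c q * y q a) *
      Real.exp (-(δ / 2) * ∑ b, ((y p₀ b - ∑ q, c q * y q b) ^ 2 + (∑ q, c q * y q b) ^ 2))) y
      (fun q b => if b = a then c q else 0) =
    (∑ q, c q ^ 2) *
        (-δ * (y p₀ a - ∑ q, c q * y q a) * (∑ q, c q * y q a) *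
          Real.exp (-(δ / 2) * ∑ b, ((y p₀ b - ∑ q, c q * y q b) ^ 2 + (∑ q, c q * y q b) ^ 2))) +
      (c p₀ - ∑ q, c q ^ 2) *
        (Real.exp (-(δ / 2) * ∑ b, ((y p₀ b - ∑ q, c q * y q b) ^ 2 + (∑ q, c q * y q b) ^ 2)) -
          δ * (y p₀ a - ∑ q, c q * y q a) ^ 2 *
            Real.exp (-(δ / 2) * ∑ b, ((y p₀ b - ∑ q, c q * y q b) ^ 2 + (∑ q, c q * y q b) ^ 2))) := by
  sorry

end TestFun

end Summit.QuantumFields.YangMills.Cruxes.FreeProbeLawG.SteinFree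

end
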